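import Literature.NumberTheory.DiophantineGeometry.HurwitzAutomorphismBound
import HarnessLib

/-!
# Galois counting on a fibre of places in a tower `F₀ ⊆ L ⊆ M` (Stichtenoth Thm. 3.7.1, Cor. 3.7.2)

Topic `NumberTheory/DiophantineGeometry` (places `AlgFunctionField.PlaceOver`). Let `F₀ ⊆ L ⊆ M` be
algebraic function fields over `K` with `M/F₀` finite Galois and all places rational (e.g. `K`
algebraically closed), `w` a place of `M`, `P₀ = w ∩ F₀`, and `v` a place of `L` above `P₀`.
H. Stichtenoth, *Algebraic Function Fields and Codes* (2nd ed.), Thm. 3.7.1 ("the Galois group acts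
transitively on the set of extensions of `P`") and Cor. 3.7.2 (`e(P'|P) = e(P)`, `f(P'|P) = f(P)`
for all `P'|P`, and `e(P) f(P) r(P) = [F' : F]`), with Prop. 3.1.6 (b) (multiplicativity of `e` in
towers), give the following COUNT, which is the multiplicity bookkeeping behind the specialisation
of symmetric functions of the conjugates of a point (Lang, *Abelian Varieties*, II §2, proof of
Thm. 10 — Abel's theorem): the conjugates `σ⁻¹(w)`, `σ ∈ Gal(M/F₀)`, restrict to `v` exactly
`[M : L] · e(v|P₀)` times, i.e. the `F₀`-embeddings `τ : L → M` induce `v` from `w` exactly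
`e(v|P₀)` times. All PROVED, from the tree's transitivity
(`PlaceOver.exists_comapAlgEquiv_eq_of_restrict_eq`) and Galois fibre count
(`PlaceOver.card_fibre_mul_eq_finrank_of_isGalois`, `HurwitzAutomorphismBound`):

* `restrict_restrict`, `ord_algebraMap_uniformizer_tower` — `(w ∩ L) ∩ F₀ = w ∩ F₀` and
  `e(w|P₀) = e(w|v) e(v|P₀)` (Prop. 3.1.6 (b));
* `comapAlgEquiv_comapAlgEquiv`, `card_filter_comapAlgEquiv_eq`, `card_stabilizer_eq` — the orbit
  map `σ ↦ σ⁻¹(w)` has all fibres of size `e(w|P₀)` (the decomposition group has order `e · f = e`);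
* `card_filter_restrict_comapAlgEquiv_eq` — **`#{σ ∈ Gal(M/F₀) | σ⁻¹(w) ∩ L = v} = [M : L] e(v|P₀)`**,
  and `= 0` for `v` not above `P₀` (`…_eq_zero`);
* `comapEmb τ w` (the place `τ⁻¹(𝒪_w)` of `L` for an `F₀`-embedding `τ : L → M`, `mem_comapEmb_iff`),
  `card_filter_comp_eq` (the restriction `Gal(M/F₀) → Emb_{F₀}(L, M)` is `[M : L]`-to-one) and
  **`card_filter_comapEmb_eq` — `#{τ : L →_{F₀} M | τ^* w = v} = e(v|P₀)`** (`…_eq_zero` off the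
  fibre).

No definitions of `Prop`s, no named facts (D-0026).

Mathlib searched (pin): `Finset.card_eq_sum_card_fiberwise`, `Finset.card_bij`,
`IsGalois.card_aut_eq_finrank`, `IsGalois.tower_top_of_isGalois`, `AlgHom.liftNormal_commutes`,
`Algebra.IsAlgebraic.algEquivEquivAlgHom`, `AlgEquiv.restrictScalars_injective` (all used).

## References

* H. Stichtenoth, *Algebraic Function Fields and Codes*, 2nd ed., GTM 254 (2009): Prop. 3.1.6 (b),
  Thm. 3.7.1, Cor. 3.7.2. [Stichtenoth2009]
* S. Lang, *Abelian Varieties* (1959/1983), II §2 Thm. 10 (proof). [Lang1983AbelianVarieties]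
-/

noncomputable section

open scoped Classical IntermediateField
open Finset

namespace Literature.NumberTheory.DiophantineGeometry.AlgFunctionField

universe u v

variable {K : Type u} [Field K]

namespace PlaceOver

section Tower

variable {F₀ L M : Type v} [Field F₀] [Field L] [Field M]
  [Algebra K F₀] [Algebra K L] [Algebra K M] [Algebra F₀ L] [Algebra L M] [Algebra F₀ M]
  [IsScalarTower K F₀ L] [IsScalarTower K L M] [IsScalarTower K F₀ M] [IsScalarTower F₀ L M]

/-- Restriction of places is transitive in a tower `F₀ ⊆ L ⊆ M`: `(Q ∩ L) ∩ F₀ = Q ∩ F₀`.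
[folklore] -/
theorem restrict_restrict [IsAlgFunctionField K F₀] [IsAlgFunctionField K L]
    [FiniteDimensional F₀ L] [FiniteDimensional L M] [FiniteDimensional F₀ M] (w : PlaceOver K M) :
    (w.restrict (K := K) (F := L)).restrict (K := K) (F := F₀) = w.restrict (K := K) (F := F₀) := by
  apply PlaceOver.ext
  ext x
  change algebraMap L M (algebraMap F₀ L x) ∈ w.toValuationSubring ↔
    algebraMap F₀ M x ∈ w.toValuationSubring
  rw [← IsScalarTower.algebraMap_apply]

omit [IsScalarTower K F₀ L] in
/-- **Multiplicativity of ramification indices in a tower**: `e(w|P₀) = e(w|v) · e(v|P₀)` for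
`w` a place of `M` above `v = w ∩ L` above `P₀ = w ∩ F₀` (Stichtenoth Prop. 3.1.6 (b)).
[cite: Stichtenoth2009, Prop. 3.1.6(b)] -/
theorem ord_algebraMap_uniformizer_tower [IsAlgFunctionField K F₀] [IsAlgFunctionField K L]
    [FiniteDimensional F₀ L] [FiniteDimensional L M] [FiniteDimensional F₀ M] (w : PlaceOver K M) :
    w.ord (algebraMap F₀ M ((w.restrict (K := K) (F := F₀)).uniformizer : F₀)) =
      w.ord (algebraMap L M ((w.restrict (K := K) (F := L)).uniformizer : L)) *
        (w.restrict (K := K) (F := L)).ord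
          (algebraMap F₀ L ((w.restrict (K := K) (F := F₀)).uniformizer : F₀)) := by
  rw [IsScalarTower.algebraMap_apply F₀ L M, w.ord_algebraMap_eq_mul (K := K) (F := L)]

variable [IsAlgFunctionField K F₀] [IsAlgFunctionField K L] [IsAlgFunctionField K M]
  [FiniteDimensional F₀ L] [FiniteDimensional L M] [FiniteDimensional F₀ M]

/-- The orbit map `σ ↦ σ⁻¹(w)` lands in the fibre of `w ∩ F₀`. [folklore] -/
theorem restrict_comapAlgEquiv_mem (w : PlaceOver K M) (σ : M ≃ₐ[F₀] M) :
    w.comapAlgEquiv (σ.restrictScalars K) ∈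
      ((w.restrict (K := K) (F := F₀)).finite_setOf_restrict_eq (F' := M)).toFinset :=
  ((w.restrict (K := K) (F := F₀)).mem_toFinset_restrict_eq_iff _).2 (restrict_comapAlgEquiv σ w)

omit [IsAlgFunctionField K F₀] [IsAlgFunctionField K L] [FiniteDimensional F₀ L]
  [FiniteDimensional L M] [FiniteDimensional F₀ M] in
/-- Transport of places is a right action: `(τ)⁻¹((σ)⁻¹(w)) = (σ τ)⁻¹(w)`. [folklore] -/
theorem comapAlgEquiv_comapAlgEquiv (w : PlaceOver K M) (σ τ : M ≃ₐ[F₀] M) :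
    (w.comapAlgEquiv (σ.restrictScalars K)).comapAlgEquiv (τ.restrictScalars K) =
      w.comapAlgEquiv ((σ * τ).restrictScalars K) := by
  apply PlaceOver.ext
  ext x
  rfl

omit [IsAlgFunctionField K F₀] [IsAlgFunctionField K L] [FiniteDimensional F₀ L]
  [FiniteDimensional L M] in
/-- **All fibres of the orbit map have the cardinality of the stabiliser.** [folklore] -/
theorem card_filter_comapAlgEquiv_eq (w : PlaceOver K M) (σ₀ : M ≃ₐ[F₀] M) :
    (univ.filter fun σ : M ≃ₐ[F₀] M =>
        w.comapAlgEquiv (σ.restrictScalars K) = w.comapAlgEquiv (σ₀.restrictScalars K)).card =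
      (univ.filter fun σ : M ≃ₐ[F₀] M => w.comapAlgEquiv (σ.restrictScalars K) = w).card := by
  symm
  refine Finset.card_bij (fun s _ => s * σ₀) (fun s hs => ?_) (fun s₁ _ s₂ _ h => ?_)
    (fun σ hσ => ?_)
  · rw [mem_filter] at hs ⊢
    refine ⟨mem_univ _, ?_⟩
    rw [← comapAlgEquiv_comapAlgEquiv, hs.2]
  · exact mul_right_cancel h
  · rw [mem_filter] at hσ
    refine ⟨σ * σ₀⁻¹, ?_, by rw [inv_mul_cancel_right]⟩
    rw [mem_filter]
    refine ⟨mem_univ _, ?_⟩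
    rw [← comapAlgEquiv_comapAlgEquiv, hσ.2, comapAlgEquiv_comapAlgEquiv, mul_inv_cancel]
    exact comapAlgEquiv_one w

/-- **The stabiliser of a place has `e` elements** (`F₀ ⊆ M` Galois, all places rational): the
orbit map `Gal(M/F₀) → {w' | F₀-fibre}` is onto (transitivity, Stichtenoth Thm. 3.7.1) with
fibres of equal size `s`, so `|G| = r · s`, while `r · e = [M : F₀] = |G|` (Cor. 3.7.2).
[cite: Stichtenoth2009, Thm. 3.7.1 and Cor. 3.7.2] -/
theorem card_stabilizer_eq [IsGalois F₀ M] (hrat₀ : ∀ P₀ : PlaceOver K F₀, P₀.IsRational)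
    (hratM : ∀ w : PlaceOver K M, w.IsRational) (w : PlaceOver K M) :
    ((univ.filter fun σ : M ≃ₐ[F₀] M => w.comapAlgEquiv (σ.restrictScalars K) = w).card : ℤ) =
      w.ord (algebraMap F₀ M ((w.restrict (K := K) (F := F₀)).uniformizer : F₀)) := by
  set P₀ := w.restrict (K := K) (F := F₀) with hP₀
  set U := (P₀.finite_setOf_restrict_eq (F' := M)).toFinset with hU
  have hmemU : ∀ w' : PlaceOver K M, w' ∈ U ↔ w'.restrict (K := K) (F := F₀) = P₀ := fun w' =>
    P₀.mem_toFinset_restrict_eq_iff w'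
  obtain ⟨e, he, hall, hcard⟩ := card_fibre_mul_eq_finrank_of_isGalois (K := K) (F₀ := F₀) (F := M)
    hrat₀ hratM P₀
  have hwU : w ∈ U := (hmemU w).2 rfl
  -- `|G| = Σ_{w' ∈ U} #fibre(w') = #U · s`
  set s := (univ.filter fun σ : M ≃ₐ[F₀] M => w.comapAlgEquiv (σ.restrictScalars K) = w).card
    with hs
  have hfib : ∀ w' ∈ U,
      (univ.filter fun σ : M ≃ₐ[F₀] M => w.comapAlgEquiv (σ.restrictScalars K) = w').card = s := by
    intro w' hw'
    obtain ⟨σ₀, rfl⟩ := exists_comapAlgEquiv_eq_of_restrict_eq P₀ rfl ((hmemU w').1 hw')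
    exact card_filter_comapAlgEquiv_eq w σ₀
  have hG : (univ : Finset (M ≃ₐ[F₀] M)).card = U.card * s := by
    rw [card_eq_sum_card_fiberwise (f := fun σ : M ≃ₐ[F₀] M => w.comapAlgEquiv (σ.restrictScalars K))
      (t := U) fun σ _ => restrict_comapAlgEquiv_mem w σ, sum_congr rfl hfib, sum_const,
      smul_eq_mul]
  have hGal : (univ : Finset (M ≃ₐ[F₀] M)).card = Module.finrank F₀ M := by
    rw [card_univ, ← Nat.card_eq_fintype_card, IsGalois.card_aut_eq_finrank]
  -- compare with `#U · e = [M : F₀]`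
  have h1 : ((U.card : ℤ)) * s = U.card * e := by
    have : ((U.card * s : ℕ) : ℤ) = Module.finrank F₀ M := by rw [← hG, hGal]
    push_cast at this
    rw [this, ← hcard]
  have hUpos : 0 < U.card := card_pos.2 ⟨w, hwU⟩
  have h2 : (s : ℤ) = e := by
    have hU0 : (U.card : ℤ) ≠ 0 := by exact_mod_cast hUpos.ne'
    exact mul_left_cancel₀ hU0 h1
  rw [h2, hall w hwU]

/-- **Galois counting on a fibre of a tower.** Let `F₀ ⊆ L ⊆ M` be function fields over `K` with
`M/F₀` Galois and all places rational, `w` a place of `M` and `v` a place of `L` above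
`P₀ = w ∩ F₀`. Then the number of `σ ∈ Gal(M/F₀)` with `σ⁻¹(w) ∩ L = v` is `[M : L] · e(v|P₀)`:
the `σ`'s with `σ⁻¹(w)` above `v` form `r_v` fibres of the orbit map, each of size `e = e(w'|P₀)`
(`card_stabilizer_eq`), and `r_v · e = r_v · e(w'|v) · e(v|P₀) = [M : L] · e(v|P₀)` by the Galois
fibre count for `M/L` (Stichtenoth Cor. 3.7.2) and multiplicativity of `e` in towers.
[cite: Stichtenoth2009, Thm. 3.7.1, Cor. 3.7.2 and Prop. 3.1.6(b)] -/
theorem card_filter_restrict_comapAlgEquiv_eq [IsGalois F₀ M]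
    (hrat₀ : ∀ P₀ : PlaceOver K F₀, P₀.IsRational) (hratL : ∀ v : PlaceOver K L, v.IsRational)
    (hratM : ∀ w : PlaceOver K M, w.IsRational) (w : PlaceOver K M) (v : PlaceOver K L)
    (hv : v.restrict (K := K) (F := F₀) = w.restrict (K := K) (F := F₀)) :
    ((univ.filter fun σ : M ≃ₐ[F₀] M =>
        (w.comapAlgEquiv (σ.restrictScalars K)).restrict (K := K) (F := L) = v).card : ℤ) =
      Module.finrank L M * v.ord (algebraMap F₀ L ((w.restrict (K := K) (F := F₀)).uniformizer : F₀)) := by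
  haveI : IsGalois L M := IsGalois.tower_top_of_isGalois F₀ L M
  set P₀ := w.restrict (K := K) (F := F₀) with hP₀
  set U := (P₀.finite_setOf_restrict_eq (F' := M)).toFinset with hU
  have hmemU : ∀ w' : PlaceOver K M, w' ∈ U ↔ w'.restrict (K := K) (F := F₀) = P₀ := fun w' =>
    P₀.mem_toFinset_restrict_eq_iff w'
  set Uv := (v.finite_setOf_restrict_eq (F' := M)).toFinset with hUv
  have hmemUv : ∀ w' : PlaceOver K M, w' ∈ Uv ↔ w'.restrict (K := K) (F := L) = v := fun w' =>
    v.mem_toFinset_restrict_eq_iff w'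
  have hUvU : Uv ⊆ U := fun w' hw' => by
    rw [hmemU, ← restrict_restrict (L := L), (hmemUv w').1 hw', hv]
  -- the `σ` with `σ⁻¹(w) ∩ L = v` are those with `σ⁻¹(w) ∈ Uv`
  have hfilter : (univ.filter fun σ : M ≃ₐ[F₀] M =>
      (w.comapAlgEquiv (σ.restrictScalars K)).restrict (K := K) (F := L) = v) =
      univ.filter fun σ : M ≃ₐ[F₀] M => w.comapAlgEquiv (σ.restrictScalars K) ∈ Uv := by
    ext σ; simp only [mem_filter, mem_univ, true_and, hmemUv]
  -- sum over the fibres of the orbit map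
  obtain ⟨e, he, hall, hcard⟩ := card_fibre_mul_eq_finrank_of_isGalois (K := K) (F₀ := F₀) (F := M)
    hrat₀ hratM P₀
  have hstab := card_stabilizer_eq (K := K) (F₀ := F₀) hrat₀ hratM w
  rw [hall w ((hmemU w).2 rfl)] at hstab
  have hfib : ∀ w' ∈ Uv, ((univ.filter fun σ : M ≃ₐ[F₀] M =>
      w.comapAlgEquiv (σ.restrictScalars K) = w').card : ℤ) = e := by
    intro w' hw'
    obtain ⟨σ₀, rfl⟩ := exists_comapAlgEquiv_eq_of_restrict_eq P₀ rfl ((hmemU _).1 (hUvU hw'))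
    rw [card_filter_comapAlgEquiv_eq w σ₀, hstab]
  have hsum : ((univ.filter fun σ : M ≃ₐ[F₀] M => w.comapAlgEquiv (σ.restrictScalars K) ∈ Uv).card : ℤ)
      = Uv.card * e := by
    rw [card_eq_sum_card_fiberwise (f := fun σ : M ≃ₐ[F₀] M => w.comapAlgEquiv (σ.restrictScalars K))
      (s := univ.filter fun σ : M ≃ₐ[F₀] M => w.comapAlgEquiv (σ.restrictScalars K) ∈ Uv)
      (t := Uv) fun σ hσ => (mem_filter.1 (Finset.mem_coe.1 hσ)).2]
    push_cast
    rw [sum_congr rfl fun w' hw' => ?_, sum_const, nsmul_eq_mul]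
    rw [filter_filter]
    have : (univ.filter fun σ : M ≃ₐ[F₀] M => w.comapAlgEquiv (σ.restrictScalars K) ∈ Uv ∧
        w.comapAlgEquiv (σ.restrictScalars K) = w') =
        univ.filter fun σ : M ≃ₐ[F₀] M => w.comapAlgEquiv (σ.restrictScalars K) = w' := by
      ext σ
      simp only [mem_filter, mem_univ, true_and, and_iff_right_iff_imp]
      rintro rfl; exact hw'
    rw [this, hfib w' hw']
  -- the Galois fibre count for `M/L` at `v`, and multiplicativity of `e`
  obtain ⟨ev, hev, hallv, hcardv⟩ := card_fibre_mul_eq_finrank_of_isGalois (K := K) (F₀ := L) (F := M)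
    hratL hratM v
  obtain ⟨w₁, hw₁⟩ := v.exists_restrict_eq' (F' := M)
  have hw₁U : w₁ ∈ Uv := (hmemUv w₁).2 hw₁
  have hw₁P₀ : w₁.restrict (K := K) (F := F₀) = P₀ := (hmemU w₁).1 (hUvU hw₁U)
  have hmult := ord_algebraMap_uniformizer_tower (K := K) (F₀ := F₀) (L := L) w₁
  rw [hw₁P₀, hw₁, hall w₁ (hUvU hw₁U), hallv w₁ hw₁U] at hmult
  -- assemble
  rw [hfilter, hsum]
  have hc : ((Uv.card : ℤ)) * ev = Module.finrank L M := by rw [hUv]; exact hcardv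
  calc ((Uv.card : ℤ)) * e = Uv.card * (ev * v.ord (algebraMap F₀ L (P₀.uniformizer : F₀))) := by
        rw [hmult]
    _ = Module.finrank L M * v.ord (algebraMap F₀ L (P₀.uniformizer : F₀)) := by
        rw [← mul_assoc, hc]

/-- Places of `L` not above `w ∩ F₀` are never of the form `σ⁻¹(w) ∩ L`. [folklore] -/
theorem card_filter_restrict_comapAlgEquiv_eq_zero (w : PlaceOver K M) (v : PlaceOver K L)
    (hv : v.restrict (K := K) (F := F₀) ≠ w.restrict (K := K) (F := F₀)) :
    (univ.filter fun σ : M ≃ₐ[F₀] M =>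
        (w.comapAlgEquiv (σ.restrictScalars K)).restrict (K := K) (F := L) = v).card = 0 := by
  rw [card_eq_zero, filter_eq_empty_iff]
  intro σ _ h
  apply hv
  rw [← h, restrict_restrict, restrict_comapAlgEquiv]

/-! ### The same count over the `F₀`-embeddings `L → M` -/

/-- The place `τ^*(w) = τ⁻¹(𝒪_w)` of `L` induced from a place `w` of `M` by an `F₀`-embedding
`τ : L → M`: transport `w` along a lift of `τ` to `Gal(M/F₀)` and restrict to `L`. [folklore] -/
def comapEmb [Normal F₀ M] (τ : L →ₐ[F₀] M) (w : PlaceOver K M) : PlaceOver K L :=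
  (w.comapAlgEquiv (((Algebra.IsAlgebraic.algEquivEquivAlgHom F₀ M).symm
    (τ.liftNormal M)).restrictScalars K)).restrict (K := K) (F := L)

omit [IsScalarTower K F₀ L] [IsAlgFunctionField K F₀] [FiniteDimensional F₀ L] in
/-- Membership in `τ^*(w)`: `x ∈ 𝒪_{τ^* w} ↔ τ x ∈ 𝒪_w`. [folklore] -/
theorem mem_comapEmb_iff [Normal F₀ M] (τ : L →ₐ[F₀] M) (w : PlaceOver K M) (x : L) :
    x ∈ (comapEmb (K := K) τ w).toValuationSubring ↔ τ x ∈ w.toValuationSubring := by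
  have h : ∀ y, ((Algebra.IsAlgebraic.algEquivEquivAlgHom F₀ M).symm (τ.liftNormal M)) y =
      τ.liftNormal M y := fun y => rfl
  change ((Algebra.IsAlgebraic.algEquivEquivAlgHom F₀ M).symm (τ.liftNormal M))
    (algebraMap L M x) ∈ w.toValuationSubring ↔ _
  rw [h, AlgHom.liftNormal_commutes]
  rfl

omit [IsScalarTower K F₀ L] [IsAlgFunctionField K F₀] [FiniteDimensional F₀ L] in
/-- For `σ ∈ Gal(M/F₀)`, the place induced by the embedding `σ|_L` is `σ⁻¹(w) ∩ L`. [folklore] -/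
theorem comapEmb_comp_eq [Normal F₀ M] (σ : M ≃ₐ[F₀] M) (w : PlaceOver K M) :
    comapEmb (K := K) (σ.toAlgHom.comp (IsScalarTower.toAlgHom F₀ L M)) w =
      (w.comapAlgEquiv (σ.restrictScalars K)).restrict (K := K) (F := L) := by
  apply PlaceOver.ext
  ext x
  rw [mem_comapEmb_iff]
  rfl

omit [FiniteDimensional F₀ L] [FiniteDimensional L M] in
/-- A lift of an `F₀`-embedding `L → M` to `Gal(M/F₀)` (`M/F₀` normal). [folklore] -/
theorem exists_algEquiv_comp_eq [Normal F₀ M] (τ : L →ₐ[F₀] M) :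
    ∃ σ : M ≃ₐ[F₀] M, σ.toAlgHom.comp (IsScalarTower.toAlgHom F₀ L M) = τ :=
  ⟨(Algebra.IsAlgebraic.algEquivEquivAlgHom F₀ M).symm (τ.liftNormal M), by
    ext x
    have h : ∀ y, ((Algebra.IsAlgebraic.algEquivEquivAlgHom F₀ M).symm (τ.liftNormal M)) y =
        τ.liftNormal M y := fun y => rfl
    change ((Algebra.IsAlgebraic.algEquivEquivAlgHom F₀ M).symm (τ.liftNormal M))
      (algebraMap L M x) = τ x
    rw [h, AlgHom.liftNormal_commutes]
    rfl⟩

omit [FiniteDimensional F₀ L] in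
/-- **The fibres of `Gal(M/F₀) → Emb_{F₀}(L, M)`, `σ ↦ σ|_L`, have `[M : L]` elements** (they are
cosets of `Gal(M/L)`). [folklore] -/
theorem card_filter_comp_eq [IsGalois F₀ M] (τ : L →ₐ[F₀] M) :
    (univ.filter fun σ : M ≃ₐ[F₀] M =>
        σ.toAlgHom.comp (IsScalarTower.toAlgHom F₀ L M) = τ).card = Module.finrank L M := by
  haveI : IsGalois L M := IsGalois.tower_top_of_isGalois F₀ L M
  obtain ⟨σ₀, hσ₀⟩ := exists_algEquiv_comp_eq τ
  rw [← IsGalois.card_aut_eq_finrank, Nat.card_eq_fintype_card, ← card_univ]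
  symm
  refine Finset.card_bij (fun θ _ => σ₀ * θ.restrictScalars F₀) (fun θ _ => ?_)
    (fun θ₁ _ θ₂ _ h => ?_) (fun σ hσ => ?_)
  · rw [mem_filter]
    refine ⟨mem_univ _, ?_⟩
    ext x
    change σ₀ (θ (algebraMap L M x)) = τ x
    rw [AlgEquiv.commutes, ← hσ₀]
    rfl
  · exact AlgEquiv.restrictScalars_injective F₀ (mul_left_cancel h)
  · rw [mem_filter] at hσ
    have hfix : ∀ x : L, (σ₀⁻¹ * σ) (algebraMap L M x) = algebraMap L M x := by
      intro x
      change σ₀.symm (σ (algebraMap L M x)) = algebraMap L M x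
      rw [AlgEquiv.symm_apply_eq]
      have h1 : σ (algebraMap L M x) = τ x := by rw [← hσ.2]; rfl
      have h2 : σ₀ (algebraMap L M x) = τ x := by rw [← hσ₀]; rfl
      rw [h1, h2]
    let θ : M ≃ₐ[L] M :=
      { (σ₀⁻¹ * σ : M ≃ₐ[F₀] M) with
        commutes' := hfix }
    refine ⟨θ, mem_univ _, ?_⟩
    have hθ : θ.restrictScalars F₀ = σ₀⁻¹ * σ := AlgEquiv.ext fun x => rfl
    change σ₀ * θ.restrictScalars F₀ = σ
    rw [hθ, mul_inv_cancel_left]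

/-- **Galois counting over embeddings**: with `w`, `v`, `P₀ = w ∩ F₀` as in
`card_filter_restrict_comapAlgEquiv_eq`, the number of `F₀`-embeddings `τ : L → M` with
`τ^*(w) = v` is exactly the ramification index `e(v|P₀)`. [cite: Stichtenoth2009, Thm. 3.7.1 and Cor. 3.7.2] -/
theorem card_filter_comapEmb_eq [IsGalois F₀ M]
    (hrat₀ : ∀ P₀ : PlaceOver K F₀, P₀.IsRational) (hratL : ∀ v : PlaceOver K L, v.IsRational)
    (hratM : ∀ w : PlaceOver K M, w.IsRational) (w : PlaceOver K M) (v : PlaceOver K L)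
    (hv : v.restrict (K := K) (F := F₀) = w.restrict (K := K) (F := F₀)) :
    ((univ.filter fun τ : L →ₐ[F₀] M => comapEmb (K := K) τ w = v).card : ℤ) =
      v.ord (algebraMap F₀ L ((w.restrict (K := K) (F := F₀)).uniformizer : F₀)) := by
  set res : (M ≃ₐ[F₀] M) → (L →ₐ[F₀] M) := fun σ =>
    σ.toAlgHom.comp (IsScalarTower.toAlgHom F₀ L M) with hres
  have hG := card_filter_restrict_comapAlgEquiv_eq (K := K) (F₀ := F₀) (L := L) (M := M)
    hrat₀ hratL hratM w v hv
  -- the `σ`-count factors through `res`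
  have hσ : (univ.filter fun σ : M ≃ₐ[F₀] M =>
      (w.comapAlgEquiv (σ.restrictScalars K)).restrict (K := K) (F := L) = v) =
      univ.filter fun σ : M ≃ₐ[F₀] M => comapEmb (K := K) (res σ) w = v := by
    ext σ
    simp only [mem_filter, mem_univ, true_and, hres, comapEmb_comp_eq]
  have hsum : (univ.filter fun σ : M ≃ₐ[F₀] M => comapEmb (K := K) (res σ) w = v).card =
      Module.finrank L M * (univ.filter fun τ : L →ₐ[F₀] M => comapEmb (K := K) τ w = v).card := by
    rw [card_eq_sum_card_fiberwise (f := res)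
      (s := univ.filter fun σ : M ≃ₐ[F₀] M => comapEmb (K := K) (res σ) w = v)
      (t := univ.filter fun τ : L →ₐ[F₀] M => comapEmb (K := K) τ w = v) fun σ hσ => by
        have hσ' := (mem_filter.1 (Finset.mem_coe.1 hσ)).2
        exact Finset.mem_coe.2 (mem_filter.2 ⟨mem_univ _, hσ'⟩)]
    rw [sum_congr rfl fun τ hτ => ?_, sum_const, smul_eq_mul, mul_comm]
    rw [filter_filter]
    rw [mem_filter] at hτ
    have : (univ.filter fun σ : M ≃ₐ[F₀] M => comapEmb (K := K) (res σ) w = v ∧ res σ = τ) =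
        univ.filter fun σ : M ≃ₐ[F₀] M => res σ = τ := by
      ext σ
      simp only [mem_filter, mem_univ, true_and, and_iff_right_iff_imp]
      rintro rfl; exact hτ.2
    rw [this, hres, card_filter_comp_eq]
  rw [hσ, hsum] at hG
  push_cast at hG
  have hpos : (0 : ℤ) < Module.finrank L M := by exact_mod_cast Module.finrank_pos
  exact mul_left_cancel₀ hpos.ne' hG

/-- Embedding form of `card_filter_restrict_comapAlgEquiv_eq_zero`. [folklore] -/
theorem card_filter_comapEmb_eq_zero [Normal F₀ M] (w : PlaceOver K M) (v : PlaceOver K L)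
    (hv : v.restrict (K := K) (F := F₀) ≠ w.restrict (K := K) (F := F₀)) :
    (univ.filter fun τ : L →ₐ[F₀] M => comapEmb (K := K) τ w = v).card = 0 := by
  rw [card_eq_zero, filter_eq_empty_iff]
  intro τ _ h
  obtain ⟨σ, rfl⟩ := exists_algEquiv_comp_eq τ
  apply hv
  rw [← h, comapEmb_comp_eq, restrict_restrict, restrict_comapAlgEquiv]

end Tower

end PlaceOver

end Literature.NumberTheory.DiophantineGeometry.AlgFunctionField
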